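import Literature.Geometry.Lorentzian.Hintz2026.KerrDualMetricForm

/-!
# Hintz 2026, §6.1 (with Hintz, *Gluing II*, §3.2.3): the Carter tetrad of the Kerr metric, the Carter constant
# in Boyer–Lindquist momenta, the Marck-type frame `e^μ` of `π*T*𝓜_b` with its Gram matrix (6.16a), and the
# closing step of Lemma 6.4 — kernel reproduction for ALL parameters `(𝔪, a)`

#harness_tags [topic Geometry/Lorentzian]

CITATION HEADER (lean-in-tree rule 2026-08-18).  P. Hintz, *Nonlinear stability of subextremal Kerr black holes*,
arXiv:2606.28253 **v2** (2026-08-03), bib key `Hintz2026` — an UNREFEREED CLAIM under adjudication in this library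
(`Literature.Geometry.Lorentzian.hintz_kerr_stability_subextremal_cauchy` carries its main theorem as
`@[claim "Hintz2026" "under-review"]`); "H l.N" = line N of the v2 TeX source `kerr-stab-r.tex` (md5 2c6513182847).
P. Hintz, *Gluing small black holes along timelike geodesics II*, arXiv:2408.06712 (bib `Hintz2024GluingII`, "GII";
UNREFEREED preprint; "GII l.N" = line N of its TeX source `glueloc2.tex`, md5 150225951188) is the source Hintz cites for
the frame.  The tetrad is B. Carter's (Comm. Math. Phys. 10 (1968) 280–310, §4; bib `Carter1968`, REFEREED); the
frame follows J.-A. Marck, Phys. Lett. A 97 (1983) 140–142.  Written by the audit cell `pub-kerr` (HINTZ-PLAN.md P37;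
GAPS.md C-A21).  Nothing in this file is a stability statement, an estimate, or a statement about the trapped set
`Γ₀`: it is finite algebra on printed expressions, valid for every real `𝔪`, `a` wherever the printed divisors
(`μ`, `ϱ²`, `sin θ`) are non-zero — no smallness of `a` and no sub-extremality is used.

## What is printed

* H l.5984–5988 (v2 PDF p.114): "the *Carter constant* `𝒞 := η_θ² + sin⁻²θ(−a sin²θ σ + η_ϕ)²` does not vanish on
  `Γ₀`; here we use coordinates on `T*𝓜_b°` defined by writing covectors in the form `−σ d𝔱 + ξ dr + η_θ dθ + η_ϕ dϕ`.
  … this quantity is conserved along the Hamiltonian flow of `G_b` in the characteristic set `G_b⁻¹(0)`, where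
  `G_b(ζ) := g_b⁻¹(ζ,ζ)` is the dual metric function."
* (6.15) `EqWGTrTetrad` (H l.5991–5997; = GII (3.x) `EqGlDynTrCarter` l.2867–2875, "Following Carter [Car68, §4]"):
  `ω^(0) := (√μ_b/ϱ_a)(d𝔱 − a sin²θ dϕ)`, `ω^(1) := (ϱ_a/√μ_b)dr`, `ω^(2) := ϱ_a dθ`, `ω^(3) := ϱ_a⁻¹ sinθ (a d𝔱 − (r²+a²)dϕ)`;
  "write `ω_(μ)` for the dual tetrad" — GII l.2877–2882 prints it: `ω_(0) = (ϱ√μ)⁻¹((a²+r²)∂_𝔱 + a∂_ϕ)`,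
  `ω_(1) = (√μ/ϱ)∂_r`, `ω_(2) = ϱ⁻¹∂_θ`, `ω_(3) = −(ϱ sinθ)⁻¹(a sin²θ ∂_𝔱 + ∂_ϕ)`; GII l.2883: "In this frame, the Kerr
  metric is given by the Minkowski matrix `ĝ_b(ω_(μ),ω_(ν)) = η_{μν}` …, likewise for the dual metric."
* H l.5998: "(One can then check that `𝒞 = ϱ_a²(ω_(2)² + ω_(3)²)`.)" (`ω_(μ)` = the component `ζ(ω_(μ))` of the covector);
  GII l.2883–2890: off the characteristic set `𝒞 = ϱ²(ω_(2)² + ω_(3)²) − a²cos²θ Ĝ_b`.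
* The frame (H l.5998–6003; GII (3.x) `EqGlDynTre03`/`EqGlDynTre12` l.2901–2919), coefficients in the tetrad:
  `e⁰ := (ω_(0), ω_(1), ω_(2), ω_(3))` ("In particular, `e⁰ = ζ`"), `e¹ := (rω_(1), rω_(0), −a cosθ ω_(3), a cosθ ω_(2))`,
  `e² := (ϱ²/2)(ω_(0), ω_(1), −ω_(2), −ω_(3))`, `e³ := (a cosθ ω_(1), a cosθ ω_(0), rω_(3), −rω_(2))`; GII: `e³ = KY(ζ)` with the
  Killing–Yano 2-form `KY = r ω^(2)∧ω^(3) + a cosθ ω^(0)∧ω^(1)` (GII l.2891–2894), and `e¹ = Te⁰`, `e² = Se⁰` with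
  `T = a cosθ ω^(3)∧ω^(2) + r ω^(0)∧ω^(1)`, `S = (ϱ²/2)(−I + 2((ω^(1))² − (ω^(0))²))` (GII l.2929–2933).
* (6.16a) `EqWGTrMarckInner` (H l.6004–6008; = GII Lemma 3.20 `LemmaGlDynTrFrame` l.2921–2927, whose proof ends "We omit
  the straightforward calculation of the other inner products.", l.2938): at NULL covectors,
  `(g_b⁻¹(e^μ,e^ν))_{μ,ν} = 𝒞·[[0,0,−1,0],[0,1,0,0],[−1,0,0,0],[0,0,0,1]]`.
* (6.16b)/(6.16c) (H l.6009–6019; GII Prop. 3.21): in the splitting by `𝖾^μ := 𝒞^{−1/2}e^μ`,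
  `∇^{π*T*}_{H_{G_b}} = H_{G_b} + 2σN`, `N = [[0,1,0,0],[0,0,1,0],[0,0,0,0],[0,0,0,0]]` — NOT reproduced here (it needs the
  Levi-Civita connection; the cell's CAS engines reproduce it up to the sign datum SRC-A16, GAPS C-A8).
* Proof of Lemma 6.4 `LemmaWGTr` (H l.6021–6023, p.115): "with respect to the inner product `diag(1,η⁻¹,η⁻²,η⁻³)` in the
  splitting (6.16b), where `η ∈ (0,1)`, the matrix in (6.16c) has operator norm of size `𝒪(η)`, and thus also real part
  of size `𝒪(η)`. Choosing `η` to be a small multiple of `ε` yields (6.14)."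

## What is proved here (all real `𝔪, a, r, s2 = sin²θ, c = a cosθ, …`; only non-vanishing of divisors assumed)

1. (§1) **The Carter tetrad is orthonormal for the Boyer–Lindquist Kerr metric of `KerrDualMetricForm` (`QBL`, `GBL`),
   for ALL `(𝔪, a)`.**  Square roots are avoided by splitting each printed (co)vector into a polynomial part and its
   scalar normalisation, of which only SQUARES enter: `Theta` (rows `θ^κ`: `ω^(κ) = σ_κθ^κ`), `scalSq` (`σ_κ²`), `Vfr` (rows
   `v_κ`: `ω_(κ) = τ_κv_κ`), `dscalSq` (`τ_κ²`).  `theta_QBL` : `Θ·(ϱ²g⁻¹)·Θᵀ = diag(−ϱ⁴/μ, μ, 1, ϱ⁴/sin²θ)` (off-diagonal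
   entries vanish identically); `tetrad_orthonormal_dual` : `σ_κ²·(that)_κκ = ϱ²η_κκ`, i.e. `g⁻¹(ω^(κ),ω^(λ)) = η^{κλ}`;
   `V_GBL` + `tetrad_orthonormal` : `g(ω_(κ),ω_(λ)) = η_{κλ}` (GII l.2883); `V_Theta` + `tetrad_duality` : `ω_(κ)(ω^(λ)) = δ`.
2. (§2) With `ζ = −σd𝔱 + ξdr + η_θdθ + η_ϕdϕ` and `w_κ := v_κ·ζ` (so `ζ(ω_(κ)) = τ_κw_κ`): `carterC_eq_tetrad` : the printed
   `𝒞` EQUALS `ϱ²(ζ(ω_(2))² + ζ(ω_(3))²)` (H l.5998); `dualMetricFn_eq_tetrad` : `G_b(ζ) = ϱ⁻²·ζQBLζ = −ζ(ω_(0))² + Σζ(ω_(i))²`.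
3. (§3) In tetrad components `z_κ = ζ(ω_(κ))` (any reals), with `c = a cosθ`, `P = r² + c²` (`= ϱ²`, `P_eq_rhoSq`): the frame
   `e0 … e3` as printed; `e3_eq_KY`, `e1_eq_T`, `e2_eq_S` (GII's descriptions, with `KY`, `T`, `S` as the printed 2-forms /
   endomorphism acting through `η`); the TEN Gram entries OFF the characteristic set — `gram_00 … gram_33` : `Gram =
   𝒞̃·J + G·K` with `𝒞̃ = P(z₂² + z₃²)`, `G = −z₀² + z₁² + z₂² + z₃²` and an explicit `K` — hence **`gram_onshell`** : at `G = 0`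
   the Gram matrix IS `𝒞·J`, `J = [[0,0,−1,0],[0,1,0,0],[−1,0,0,0],[0,0,0,1]]` = (6.16a) = GII Lemma 3.20 including the entries
   GII omits; `Jmat_sq` (`J² = 1`) and `gram_onshell_mul_inv` : on shell `Gram·(𝒞⁻¹J) = 1` (a frame iff `𝒞 ≠ 0`).
4. (§4) The closing step of Lemma 6.4: `Nmat`; the printed inner product `diag(1,η⁻¹,η⁻²,η⁻³)` through its positive multiple
   `ipP t = η³·diag(1,η⁻¹,η⁻²,η⁻³) = diag(η³,η²,η,1)`, `η = t²` (`ipP_eq_scaled_printed`; proportional inner products have the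
   same adjoints and norm ratios); `normSq_N_le` + `normSq_N_witness` : `‖Nu‖² ≤ η‖u‖²` with EQUALITY at `u = 𝖾¹`, so the
   operator norm of `N` is EXACTLY `η^{1/2}` — audit datum **SRC-A40**: the printed "of size `𝒪(η)`" holds for the SQUARED norm
   (or for the weights `diag(1,η⁻²,η⁻⁴,η⁻⁶)`, which is `ipP η`), not for the norm; `realPart_N_le`, `realPart_N_ge`,
   `realPart_N_witness` : `|⟨Nu,u⟩| ≤ η^{1/2}‖u‖²`, attained up to a factor `2`; NIL for the Lemma: `lemma64_closing` : for every
   `ε > 0` the weights with `η = ε²/16` give `−⟨(N+N*)u,u⟩ ≤ (ε/2)‖u‖²`, which is (6.14) once (6.16c) and the adjoint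
   bookkeeping of H l.7530 (`H_G* = −H_G` for constant componentwise inner products) are granted.
NOT formalised: that `𝒞 ≠ 0` on `Γ₀`, the structure of `Γ₀`, (6.16c), the conservation `H_{G_b}𝒞 = 0` (Carter 1968; in this
library for null geodesics in Kerr–Schild coordinates: `Literature.Geometry.Lorentzian.KerrCarterConstant`), smoothness
of `e^μ` as sections.

Second engine (standard library, exact rationals, random rational points, every identity of this file):
`code/adep1-g21/carter_tetrad_engineB_exact.py` of the cell.  |a|-census (ADEP.md): NIL — every identity holds for all
real `a`; the tetrad degenerates only where `μ = 0` (the horizons), `ϱ = 0` or `sin θ = 0` (the axis), as printed.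
[cite: Hintz2026, §6.1: TeX l.5984-5988 (Carter constant, momenta), eq. (6.15) `EqWGTrTetrad` l.5991-5997, the frame
l.5998-6003, eq. (6.16a) `EqWGTrMarckInner` l.6004-6008, (6.16b) `EqWGTrMarckSplit` l.6010-6013, proof of Lemma 6.4
`LemmaWGTr` l.6021-6023 (claims under review; the algebra is reproduced here)]
[cite: Hintz2024GluingII, §3.2.3: Carter tetrad and dual tetrad TeX l.2866-2883, Carter constant l.2883-2890,
Killing-Yano tensor l.2891-2894, frame (EqGlDynTre03)/(EqGlDynTre12) l.2901-2919, Lemma 3.20 `LemmaGlDynTrFrame`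
l.2921-2939 (preprint; the algebra is reproduced here)] [cite: Carter1968, §4 (the tetrad)]
-/

open Matrix

noncomputable section

namespace Literature.Geometry.Lorentzian.Hintz2026.CarterTetradFrame

open Literature.Geometry.Lorentzian.Hintz2026.KerrDualMetricForm

/-! ## 1. The Carter tetrad (6.15) is orthonormal for the Boyer–Lindquist Kerr metric, for all `(𝔪, a)` -/

/-- Polynomial parts `θ^κ` of the printed coframe (6.15), rows on `(d𝔱, dr, dθ, dϕ)`: `θ⁰ = d𝔱 − a sin²θ dϕ`, `θ¹ = dr`,
`θ² = dθ`, `θ³ = a d𝔱 − (r²+a²)dϕ`; the printed `ω^(0) = (√μ/ϱ)θ⁰`, `ω^(1) = (ϱ/√μ)θ¹`, `ω^(2) = ϱθ²`, `ω^(3) = (sinθ/ϱ)θ³`.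
[cite: Hintz2026, eq. (6.15) `EqWGTrTetrad` TeX l.5991-5997 (transcription, normalisations split off)] -/
def Theta (a r s2 : ℝ) : Matrix (Fin 4) (Fin 4) ℝ :=
  !![1, 0, 0, -(a * s2); 0, 1, 0, 0; 0, 0, 1, 0; a, 0, 0, -(r ^ 2 + a ^ 2)]

/-- Squares `σ_κ²` of the printed normalisations `(√μ/ϱ, ϱ/√μ, ϱ, sinθ/ϱ)`: `(μ/ϱ², ϱ²/μ, ϱ², sin²θ/ϱ²)`.
[cite: Hintz2026, eq. (6.15) `EqWGTrTetrad` TeX l.5991-5997 (transcription)] -/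
def scalSq (m a r s2 : ℝ) : Fin 4 → ℝ :=
  ![mu m a r / rhoSq a r s2, rhoSq a r s2 / mu m a r, rhoSq a r s2, s2 / rhoSq a r s2]

/-- Polynomial parts `v_κ` of the printed dual tetrad, rows on `(∂_𝔱, ∂_r, ∂_θ, ∂_ϕ)`: `v₀ = (a²+r²)∂_𝔱 + a∂_ϕ`, `v₁ = ∂_r`,
`v₂ = ∂_θ`, `v₃ = −(a sin²θ ∂_𝔱 + ∂_ϕ)`; the printed `ω_(0) = v₀/(ϱ√μ)`, `ω_(1) = (√μ/ϱ)v₁`, `ω_(2) = v₂/ϱ`, `ω_(3) = v₃/(ϱ sinθ)`.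
[cite: Hintz2024GluingII, dual tetrad display TeX l.2877-2882 (transcription, normalisations split off)] -/
def Vfr (a r s2 : ℝ) : Matrix (Fin 4) (Fin 4) ℝ :=
  !![a ^ 2 + r ^ 2, 0, 0, a; 0, 1, 0, 0; 0, 0, 1, 0; -(a * s2), 0, 0, -1]

/-- Squares `τ_κ²` of the printed dual normalisations: `(1/(ϱ²μ), μ/ϱ², 1/ϱ², 1/(ϱ²sin²θ))`.
[cite: Hintz2024GluingII, dual tetrad display TeX l.2877-2882 (transcription)] -/
def dscalSq (m a r s2 : ℝ) : Fin 4 → ℝ :=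
  ![1 / (rhoSq a r s2 * mu m a r), mu m a r / rhoSq a r s2, 1 / rhoSq a r s2, 1 / (rhoSq a r s2 * s2)]

/-- The Minkowski diagonal `η = diag(−1, 1, 1, 1)`. [cite: Hintz2024GluingII, TeX l.2883 ("the Minkowski matrix")] -/
def etaDiag : Fin 4 → ℝ := ![-1, 1, 1, 1]

/-- `θ`-level dual Gram matrix: `Θ·(ϱ²g⁻¹_{𝔪,a})·Θᵀ = diag(−ϱ⁴/μ, μ, 1, ϱ⁴/sin²θ)` — all OFF-diagonal pairings of the Carter
coframe vanish identically, for all `(𝔪, a)` (`μ, sin θ ≠ 0`).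
[cite: Hintz2024GluingII, TeX l.2883 ("likewise for the dual metric"; computed here)] -/
theorem theta_QBL (m a r s2 : ℝ) (hμ : mu m a r ≠ 0) (hs : s2 ≠ 0) :
    Theta a r s2 * QBL m a r s2 * (Theta a r s2)ᵀ =
      Qsym (-(rhoSq a r s2) ^ 2 / mu m a r) 0 0 0 (mu m a r) 0 0 1 0 (rhoSq a r s2 ^ 2 / s2) := by
  ext i j
  fin_cases i <;> fin_cases j <;>
    simp [Theta, QBL, Qsym, Matrix.mul_apply, Fin.sum_univ_four] <;>
    field_simp <;> (simp only [mu, rhoSq]; ring)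

/-- **The Carter coframe is `g⁻¹`-orthonormal**: `g⁻¹(ω^(κ), ω^(κ)) = σ_κ²·Θ_κκ/ϱ² = η^{κκ}` for `κ = 0,…,3`, i.e. with
`theta_QBL`: `(g_b⁻¹(ω^(κ),ω^(λ))) = η` for ALL `(𝔪, a)` (`μ, ϱ², sin θ ≠ 0`).
[cite: Hintz2024GluingII, TeX l.2883; Hintz2026, eq. (6.15) TeX l.5991-5997 (reproduced)] -/
theorem tetrad_orthonormal_dual (m a r s2 : ℝ) (hμ : mu m a r ≠ 0) (hρ : rhoSq a r s2 ≠ 0) (hs : s2 ≠ 0) :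
    scalSq m a r s2 0 * (-(rhoSq a r s2) ^ 2 / mu m a r) = rhoSq a r s2 * etaDiag 0 ∧
      scalSq m a r s2 1 * mu m a r = rhoSq a r s2 * etaDiag 1 ∧
      scalSq m a r s2 2 * 1 = rhoSq a r s2 * etaDiag 2 ∧
      scalSq m a r s2 3 * (rhoSq a r s2 ^ 2 / s2) = rhoSq a r s2 * etaDiag 3 := by
  refine ⟨?_, ?_, ?_, ?_⟩ <;>
    simp only [scalSq, etaDiag, Matrix.cons_val_zero, Matrix.cons_val_one, Matrix.cons_val, mul_one] <;>
    field_simp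

/-- `v`-level covariant Gram matrix: `V·g_{𝔪,a}·Vᵀ = diag(−μϱ², ϱ²/μ, ϱ², sin²θϱ²)` — all off-diagonal pairings of the dual
tetrad vanish identically (`ϱ² ≠ 0`). [cite: Hintz2024GluingII, TeX l.2883 (computed here)] -/
theorem V_GBL (m a r s2 : ℝ) (hρ : rhoSq a r s2 ≠ 0) :
    Vfr a r s2 * GBL m a r s2 * (Vfr a r s2)ᵀ =
      Qsym (-(mu m a r * rhoSq a r s2)) 0 0 0 (rhoSq a r s2 / mu m a r) 0 0 (rhoSq a r s2) 0
        (s2 * rhoSq a r s2) := by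
  ext i j
  fin_cases i <;> fin_cases j <;>
    simp [Vfr, GBL, Qsym, Matrix.mul_apply, Fin.sum_univ_four] <;>
    field_simp <;> (simp only [mu, rhoSq]; ring)

/-- **The dual tetrad is `g`-orthonormal** (GII l.2883 "the Kerr metric is given by the Minkowski matrix
`ĝ_b(ω_(μ),ω_(ν)) = η_{μν}`"): `g(ω_(κ),ω_(κ)) = τ_κ²·(V g Vᵀ)_κκ = η_κκ`, for ALL `(𝔪, a)`.
[cite: Hintz2024GluingII, TeX l.2883 (reproduced)] -/
theorem tetrad_orthonormal (m a r s2 : ℝ) (hμ : mu m a r ≠ 0) (hρ : rhoSq a r s2 ≠ 0) (hs : s2 ≠ 0) :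
    dscalSq m a r s2 0 * (-(mu m a r * rhoSq a r s2)) = etaDiag 0 ∧
      dscalSq m a r s2 1 * (rhoSq a r s2 / mu m a r) = etaDiag 1 ∧
      dscalSq m a r s2 2 * rhoSq a r s2 = etaDiag 2 ∧
      dscalSq m a r s2 3 * (s2 * rhoSq a r s2) = etaDiag 3 := by
  simp only [dscalSq, etaDiag, Matrix.cons_val_zero, Matrix.cons_val_one, Matrix.cons_val]
  refine ⟨?_, ?_, ?_, ?_⟩ <;> field_simp

/-- `v`/`θ` pairing: `V·Θᵀ = diag(ϱ², 1, 1, ϱ²)` (`v_κ(θ^λ) = 0` for `κ ≠ λ`). [cite: Hintz2024GluingII, TeX l.2876-2882 ("The dual tetrad"; computed here)] -/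
theorem V_Theta (a r s2 : ℝ) :
    Vfr a r s2 * (Theta a r s2)ᵀ = !![rhoSq a r s2, 0, 0, 0; 0, 1, 0, 0; 0, 0, 1, 0; 0, 0, 0, rhoSq a r s2] := by
  ext i j
  fin_cases i <;> fin_cases j <;> simp [Vfr, Theta, rhoSq, Matrix.mul_apply, Fin.sum_univ_four] <;> ring

/-- **Duality**: `ω_(κ)(ω^(κ)) = τ_κσ_κ·(VΘᵀ)_κκ = 1`; stated through squares, `τ_κ²σ_κ²·(VΘᵀ)_κκ² = 1` (`κ = 0,…,3`).
[cite: Hintz2024GluingII, TeX l.2876 ("The dual tetrad ω_(μ) is given by"; reproduced)] -/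
theorem tetrad_duality (m a r s2 : ℝ) (hμ : mu m a r ≠ 0) (hρ : rhoSq a r s2 ≠ 0) (hs : s2 ≠ 0) :
    dscalSq m a r s2 0 * scalSq m a r s2 0 * rhoSq a r s2 ^ 2 = 1 ∧
      dscalSq m a r s2 1 * scalSq m a r s2 1 * 1 ^ 2 = 1 ∧
      dscalSq m a r s2 2 * scalSq m a r s2 2 * 1 ^ 2 = 1 ∧
      dscalSq m a r s2 3 * scalSq m a r s2 3 * rhoSq a r s2 ^ 2 = 1 := by
  simp only [dscalSq, scalSq, Matrix.cons_val_zero, Matrix.cons_val_one, Matrix.cons_val]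
  refine ⟨?_, ?_, ?_, ?_⟩ <;> field_simp

/-! ## 2. The Carter constant and the dual metric function in Boyer–Lindquist momenta -/

/-- The covector `ζ = −σ d𝔱 + ξ dr + η_θ dθ + η_ϕ dϕ` (components on `(d𝔱, dr, dθ, dϕ)`).
[cite: Hintz2026, TeX l.5988 (transcription)] -/
def zetaBL (σ ξ ηθ ηφ : ℝ) : Fin 4 → ℝ := ![-σ, ξ, ηθ, ηφ]

/-- Polynomial parts `w_κ := v_κ·ζ` of the tetrad components of `ζ` (`ζ(ω_(κ)) = τ_κw_κ`):
`w₀ = −(a²+r²)σ + aη_ϕ`, `w₁ = ξ`, `w₂ = η_θ`, `w₃ = a sin²θ σ − η_ϕ`. [cite: Hintz2026, TeX l.5988 and l.5998 (computed here)] -/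
def wcomp (a r s2 σ ξ ηθ ηφ : ℝ) : Fin 4 → ℝ := ![-((a ^ 2 + r ^ 2) * σ) + a * ηφ, ξ, ηθ, a * s2 * σ - ηφ]

/-- `w = V·ζ`. [cite: Hintz2024GluingII, TeX l.2877-2882 (computed here)] -/
theorem wcomp_eq (a r s2 σ ξ ηθ ηφ : ℝ) :
    wcomp a r s2 σ ξ ηθ ηφ = (Vfr a r s2).mulVec (zetaBL σ ξ ηθ ηφ) := by
  ext i
  fin_cases i <;> simp [wcomp, Vfr, zetaBL, Matrix.mulVec, dotProduct, Fin.sum_univ_four]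
  ring

/-- The Carter constant AS PRINTED: `𝒞 = η_θ² + sin⁻²θ(−a sin²θ σ + η_ϕ)²`. [cite: Hintz2026, display TeX l.5985-5987, v2 PDF p.114 (transcription)] -/
def carterC (a s2 σ ηθ ηφ : ℝ) : ℝ := ηθ ^ 2 + 1 / s2 * (-(a * s2 * σ) + ηφ) ^ 2

/-- **"One can then check that `𝒞 = ϱ_a²(ω_(2)² + ω_(3)²)`"** (H l.5998): with `ζ(ω_(κ))² = τ_κ²w_κ²`,
`ϱ²(ζ(ω_(2))² + ζ(ω_(3))²) = 𝒞` for all `(𝔪, a)` (`ϱ², sin θ ≠ 0`). [cite: Hintz2026, TeX l.5998 (reproduced); Hintz2024GluingII, TeX l.2888-2890] -/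
theorem carterC_eq_tetrad (m a r s2 σ ξ ηθ ηφ : ℝ) (hρ : rhoSq a r s2 ≠ 0) (hs : s2 ≠ 0) :
    rhoSq a r s2 * (dscalSq m a r s2 2 * wcomp a r s2 σ ξ ηθ ηφ 2 ^ 2
        + dscalSq m a r s2 3 * wcomp a r s2 σ ξ ηθ ηφ 3 ^ 2) = carterC a s2 σ ηθ ηφ := by
  simp only [dscalSq, wcomp, carterC, Matrix.cons_val]
  field_simp
  ring

/-- The dual metric function `G_b(ζ) = g_b⁻¹(ζ, ζ) = ϱ⁻²·ζ·(ϱ²g⁻¹)·ζ` in Boyer–Lindquist momenta.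
[cite: Hintz2026, TeX l.5988 ("G_b(ζ) := g_b⁻¹(ζ,ζ) is the dual metric function"; transcription)] -/
def dualMetricFn (m a r s2 σ ξ ηθ ηφ : ℝ) : ℝ :=
  1 / rhoSq a r s2 * (zetaBL σ ξ ηθ ηφ ⬝ᵥ (QBL m a r s2).mulVec (zetaBL σ ξ ηθ ηφ))

/-- **`G_b` is the Minkowski form of the tetrad components**: `G_b(ζ) = −ζ(ω_(0))² + ζ(ω_(1))² + ζ(ω_(2))² + ζ(ω_(3))²`
(`ζ(ω_(κ))² = τ_κ²w_κ²`), for all `(𝔪, a)` — so the characteristic set `{G_b = 0}` is `{−z₀² + z₁² + z₂² + z₃² = 0}` in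
tetrad components. [cite: Hintz2024GluingII, TeX l.2883 ("likewise for the dual metric"; computed here)] -/
theorem dualMetricFn_eq_tetrad (m a r s2 σ ξ ηθ ηφ : ℝ) (hμ : mu m a r ≠ 0) (hρ : rhoSq a r s2 ≠ 0) (hs : s2 ≠ 0) :
    dualMetricFn m a r s2 σ ξ ηθ ηφ =
      -(dscalSq m a r s2 0 * wcomp a r s2 σ ξ ηθ ηφ 0 ^ 2) + dscalSq m a r s2 1 * wcomp a r s2 σ ξ ηθ ηφ 1 ^ 2
        + dscalSq m a r s2 2 * wcomp a r s2 σ ξ ηθ ηφ 2 ^ 2 + dscalSq m a r s2 3 * wcomp a r s2 σ ξ ηθ ηφ 3 ^ 2 := by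
  simp [dualMetricFn, dscalSq, wcomp, zetaBL, QBL, Qsym, Matrix.mulVec, dotProduct, Fin.sum_univ_four]
  field_simp
  simp only [mu]
  ring

/-! ## 3. The frame `e^μ` in tetrad components and its Gram matrix (6.16a) -/

section Frame

variable (r c : ℝ) (z : Fin 4 → ℝ)

/-- `η(u, v) = −u₀v₀ + u₁v₁ + u₂v₂ + u₃v₃`: by §1, `g_b⁻¹` of two covectors with tetrad components `u`, `v`.
[cite: Hintz2024GluingII, TeX l.2883 (transcription)] -/
def etaForm (u v : Fin 4 → ℝ) : ℝ := -(u 0 * v 0) + u 1 * v 1 + u 2 * v 2 + u 3 * v 3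

/-- `G = −z₀² + z₁² + z₂² + z₃²` = `G_b(ζ)` in tetrad components (`dualMetricFn_eq_tetrad`). [cite: Hintz2026, TeX l.5988 (transcription)] -/
def Gtet : ℝ := etaForm z z

/-- `𝒞̃ = ϱ²(z₂² + z₃²)` with `ϱ² = P := r² + c²`, `c = a cosθ` (`carterC_eq_tetrad`, `P_eq_rhoSq`). [cite: Hintz2026, TeX l.5998 (transcription)] -/
def Ctet : ℝ := (r ^ 2 + c ^ 2) * (z 2 ^ 2 + z 3 ^ 2)

/-- `e⁰ := (ω_(0), ω_(1), ω_(2), ω_(3))` = `ζ`. [cite: Hintz2026, frame display TeX l.5999-6002 (transcription)] -/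
def e0 : Fin 4 → ℝ := z
/-- `e¹ := (rω_(1), rω_(0), −a cosθ ω_(3), a cosθ ω_(2))`. [cite: Hintz2026, frame display TeX l.5999-6002 (transcription)] -/
def e1 : Fin 4 → ℝ := ![r * z 1, r * z 0, -(c * z 3), c * z 2]
/-- `e² := (ϱ²/2)(ω_(0), ω_(1), −ω_(2), −ω_(3))`. [cite: Hintz2026, frame display TeX l.5999-6002 (transcription)] -/
def e2 : Fin 4 → ℝ :=
  ![(r ^ 2 + c ^ 2) / 2 * z 0, (r ^ 2 + c ^ 2) / 2 * z 1, -((r ^ 2 + c ^ 2) / 2 * z 2), -((r ^ 2 + c ^ 2) / 2 * z 3)]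
/-- `e³ := (a cosθ ω_(1), a cosθ ω_(0), rω_(3), −rω_(2))`. [cite: Hintz2026, frame display TeX l.5999-6002 (transcription)] -/
def e3 : Fin 4 → ℝ := ![c * z 1, c * z 0, r * z 3, -(r * z 2)]

/-- The Killing–Yano 2-form `KY = r ω^(2)∧ω^(3) + a cosθ ω^(0)∧ω^(1)` as the endomorphism `ζ ↦ KY(ζ)`,
`KY(ζ)_μ = η^{νκ}KY_{μν}ζ_κ`, on tetrad components (`KY_{23} = r`, `KY_{01} = a cosθ`; index raised with `η`).
[cite: Hintz2024GluingII, TeX l.2891-2894 and l.2906-2908 (transcription)] -/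
def KYend : Matrix (Fin 4) (Fin 4) ℝ := !![0, c, 0, 0; c, 0, 0, 0; 0, 0, 0, r; 0, 0, -r, 0]
/-- `T = a cosθ ω^(3)∧ω^(2) + r ω^(0)∧ω^(1)` as an endomorphism on tetrad components (`T_{32} = a cosθ`, `T_{01} = r`).
[cite: Hintz2024GluingII, TeX l.2931 (transcription)] -/
def Tend : Matrix (Fin 4) (Fin 4) ℝ := !![0, r, 0, 0; r, 0, 0, 0; 0, 0, 0, -c; 0, 0, c, 0]
/-- `S = (ϱ²/2)(−I + 2((ω^(1))² − (ω^(0))²))` as an endomorphism on tetrad components: `(ϱ²/2)diag(1, 1, −1, −1)`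
(`(ω^(1)⊗ω^(1))♯ = diag(0,1,0,0)`, `(ω^(0)⊗ω^(0))♯ = diag(−1,0,0,0)` after raising with `η`). [cite: Hintz2024GluingII, TeX l.2932 (transcription)] -/
def Send : Matrix (Fin 4) (Fin 4) ℝ :=
  !![(r ^ 2 + c ^ 2) / 2, 0, 0, 0; 0, (r ^ 2 + c ^ 2) / 2, 0, 0; 0, 0, -((r ^ 2 + c ^ 2) / 2), 0;
    0, 0, 0, -((r ^ 2 + c ^ 2) / 2)]

/-- `e³ = KY(ζ)` (GII (EqGlDynTre03): "their coefficients in the tetrad are … e³ = (a cosθ ω_(1), a cosθ ω_(0), rω_(3), −rω_(2))").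
[cite: Hintz2024GluingII, TeX l.2904-2912 (reproduced)] -/
theorem e3_eq_KY : e3 r c z = (KYend r c).mulVec z := by
  ext i; fin_cases i <;> simp [e3, KYend, Matrix.mulVec, dotProduct, Fin.sum_univ_four]

/-- `e¹ = Te⁰`. [cite: Hintz2024GluingII, TeX l.2929-2931 (reproduced)] -/
theorem e1_eq_T : e1 r c z = (Tend r c).mulVec (e0 z) := by
  ext i; fin_cases i <;> simp [e1, e0, Tend, Matrix.mulVec, dotProduct, Fin.sum_univ_four]

/-- `e² = Se⁰`. [cite: Hintz2024GluingII, TeX l.2929-2933 (reproduced)] -/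
theorem e2_eq_S : e2 r c z = (Send r c).mulVec (e0 z) := by
  ext i; fin_cases i <;> simp [e2, e0, Send, Matrix.mulVec, dotProduct, Fin.sum_univ_four]

/-! ### The ten pairings, OFF the characteristic set: `Gram = 𝒞̃·J + G·K` -/

/-- `g⁻¹(e⁰,e⁰) = G`. [cite: Hintz2026, eq. (6.16a) TeX l.6004-6008 (computed here, off shell)] -/
theorem gram_00 : etaForm (e0 z) (e0 z) = Gtet z := rfl

/-- `g⁻¹(e⁰,e¹) = 0` identically. [cite: Hintz2026, eq. (6.16a) TeX l.6004-6008 (computed here, off shell)] -/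
theorem gram_01 : etaForm (e0 z) (e1 r c z) = 0 := by
  simp only [etaForm, e0, e1, Matrix.cons_val_zero, Matrix.cons_val_one, Matrix.cons_val]; ring

/-- `g⁻¹(e⁰,e²) = (ϱ²/2)G − 𝒞̃`. [cite: Hintz2026, eq. (6.16a) TeX l.6004-6008 (computed here, off shell)] -/
theorem gram_02 : etaForm (e0 z) (e2 r c z) = (r ^ 2 + c ^ 2) / 2 * Gtet z - Ctet r c z := by
  simp only [etaForm, e0, e2, Gtet, Ctet, Matrix.cons_val_zero, Matrix.cons_val_one, Matrix.cons_val]; ring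

/-- `g⁻¹(e⁰,e³) = 0` identically. [cite: Hintz2026, eq. (6.16a) TeX l.6004-6008 (computed here, off shell)] -/
theorem gram_03 : etaForm (e0 z) (e3 r c z) = 0 := by
  simp only [etaForm, e0, e3, Matrix.cons_val_zero, Matrix.cons_val_one, Matrix.cons_val]; ring

/-- `g⁻¹(e¹,e¹) = 𝒞̃ − r²G`. [cite: Hintz2026, eq. (6.16a) TeX l.6004-6008 (computed here, off shell)] -/
theorem gram_11 : etaForm (e1 r c z) (e1 r c z) = Ctet r c z - r ^ 2 * Gtet z := by
  simp only [etaForm, e1, Gtet, Ctet, Matrix.cons_val_zero, Matrix.cons_val_one, Matrix.cons_val]; ring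

/-- `g⁻¹(e¹,e²) = 0` identically. [cite: Hintz2026, eq. (6.16a) TeX l.6004-6008 (computed here, off shell)] -/
theorem gram_12 : etaForm (e1 r c z) (e2 r c z) = 0 := by
  simp only [etaForm, e1, e2, Matrix.cons_val_zero, Matrix.cons_val_one, Matrix.cons_val]; ring

/-- `g⁻¹(e¹,e³) = −r(a cosθ)G`. [cite: Hintz2026, eq. (6.16a) TeX l.6004-6008 (computed here, off shell)] -/
theorem gram_13 : etaForm (e1 r c z) (e3 r c z) = -(r * c * Gtet z) := by
  simp only [etaForm, e1, e3, Gtet, Matrix.cons_val_zero, Matrix.cons_val_one, Matrix.cons_val]; ring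

/-- `g⁻¹(e²,e²) = (ϱ²/2)²G`. [cite: Hintz2026, eq. (6.16a) TeX l.6004-6008 (computed here, off shell)] -/
theorem gram_22 : etaForm (e2 r c z) (e2 r c z) = ((r ^ 2 + c ^ 2) / 2) ^ 2 * Gtet z := by
  simp only [etaForm, e2, Gtet, Matrix.cons_val_zero, Matrix.cons_val_one, Matrix.cons_val]; ring

/-- `g⁻¹(e²,e³) = 0` identically. [cite: Hintz2026, eq. (6.16a) TeX l.6004-6008 (computed here, off shell)] -/
theorem gram_23 : etaForm (e2 r c z) (e3 r c z) = 0 := by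
  simp only [etaForm, e2, e3, Matrix.cons_val_zero, Matrix.cons_val_one, Matrix.cons_val]; ring

/-- `g⁻¹(e³,e³) = 𝒞̃ − (a cosθ)²G` — GII's printed line "ĝ_b⁻¹(e³,e³) = −a²cos²θ(ω_(1)² − ω_(0)²) + r²(ω_(2)² + ω_(3)²) =
ϱ²(ω_(2)² + ω_(3)²) = 𝒞" read off shell. [cite: Hintz2024GluingII, TeX l.2934-2937 (reproduced); Hintz2026, eq. (6.16a)] -/
theorem gram_33 : etaForm (e3 r c z) (e3 r c z) = Ctet r c z - c ^ 2 * Gtet z := by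
  simp only [etaForm, e3, Gtet, Ctet, Matrix.cons_val_zero, Matrix.cons_val_one, Matrix.cons_val]; ring

/-- The frame as a `Fin 4`-indexed family. [cite: Hintz2026, frame display TeX l.5999-6002 (transcription)] -/
def frame : Fin 4 → (Fin 4 → ℝ) := ![e0 z, e1 r c z, e2 r c z, e3 r c z]

/-- The Gram matrix `(g_b⁻¹(e^μ, e^ν))_{μ,ν}` in tetrad components. [cite: Hintz2026, eq. (6.16a) TeX l.6004-6008 (transcription)] -/
def gram : Matrix (Fin 4) (Fin 4) ℝ := Matrix.of fun μ ν => etaForm (frame r c z μ) (frame r c z ν)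

/-- The printed matrix `J = [[0,0,−1,0],[0,1,0,0],[−1,0,0,0],[0,0,0,1]]` of (6.16a). [cite: Hintz2026, eq. (6.16a) `EqWGTrMarckInner` TeX l.6007 (transcription)] -/
def Jmat : Matrix (Fin 4) (Fin 4) ℝ := !![0, 0, -1, 0; 0, 1, 0, 0; -1, 0, 0, 0; 0, 0, 0, 1]

/-- The off-shell correction `K` (multiplying `G`): `[[1,0,ϱ²/2,0],[0,−r²,0,−r·a cosθ],[ϱ²/2,0,ϱ⁴/4,0],[0,−r·a cosθ,0,−a²cos²θ]]`.
[cite: Hintz2026, eq. (6.16a) TeX l.6004-6008 (computed here)] -/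
def Kmat : Matrix (Fin 4) (Fin 4) ℝ :=
  !![1, 0, (r ^ 2 + c ^ 2) / 2, 0; 0, -r ^ 2, 0, -(r * c); (r ^ 2 + c ^ 2) / 2, 0, ((r ^ 2 + c ^ 2) / 2) ^ 2, 0;
    0, -(r * c), 0, -c ^ 2]

/-- `η` is symmetric. [folklore] -/
theorem etaForm_comm (u v : Fin 4 → ℝ) : etaForm u v = etaForm v u := by
  simp only [etaForm]; ring

/-- **Gram matrix off the characteristic set**: `Gram = 𝒞̃·J + G·K`, exactly, for all `r`, `c = a cosθ` and all `z`.
[cite: Hintz2026, eq. (6.16a) `EqWGTrMarckInner` TeX l.6004-6008; Hintz2024GluingII, Lemma 3.20 TeX l.2921-2939 (computed here)] -/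
theorem gram_offshell : gram r c z = Ctet r c z • Jmat + Gtet z • Kmat r c := by
  ext μ ν
  fin_cases μ <;> fin_cases ν <;>
    simp [gram, frame, Jmat, Kmat, gram_00, gram_01, gram_02, gram_03, gram_11, gram_12, gram_13, gram_22,
      gram_23, gram_33, etaForm_comm (e1 r c z) (e0 z), etaForm_comm (e2 r c z) (e0 z),
      etaForm_comm (e3 r c z) (e0 z), etaForm_comm (e2 r c z) (e1 r c z), etaForm_comm (e3 r c z) (e1 r c z),
      etaForm_comm (e3 r c z) (e2 r c z)] <;> ring

/-- **(6.16a) / GII Lemma 3.20 on the characteristic set**: at null covectors (`G = 0`) the Gram matrix of the frame IS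
`𝒞·J` — including the six pairings whose "straightforward calculation" GII omits (l.2938) — for ALL `(𝔪, a)`.
[cite: Hintz2026, eq. (6.16a) `EqWGTrMarckInner` TeX l.6004-6008 (reproduced); Hintz2024GluingII, Lemma 3.20 `LemmaGlDynTrFrame` TeX l.2921-2939 (reproduced)] -/
theorem gram_onshell (hG : Gtet z = 0) : gram r c z = Ctet r c z • Jmat := by
  rw [gram_offshell, hG, zero_smul, add_zero]

/-- `J² = 1`: `J` is an involution (a signed permutation matrix). [cite: Hintz2026, eq. (6.16a) TeX l.6007 (computed here)] -/
theorem Jmat_sq : Jmat * Jmat = 1 := by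
  ext i j
  fin_cases i <;> fin_cases j <;> simp [Jmat, Matrix.mul_apply, Fin.sum_univ_four]

/-- On shell the Gram matrix is invertible exactly when `𝒞 ≠ 0`, with inverse `𝒞⁻¹J`: the `e^μ` form a frame at all null
covectors with `𝒞 ≠ 0` ("quasi-orthonormal frame … for which `𝒞 ≠ 0`", H l.6003). [cite: Hintz2026, TeX l.6003 and eq. (6.16a) (computed here)] -/
theorem gram_onshell_mul_inv (hG : Gtet z = 0) (hC : Ctet r c z ≠ 0) :
    gram r c z * ((Ctet r c z)⁻¹ • Jmat) = 1 := by
  rw [gram_onshell r c z hG, Matrix.smul_mul, Matrix.mul_smul, Jmat_sq, smul_smul, mul_inv_cancel₀ hC, one_smul]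

end Frame

/-- Dictionary with §§1–2: for `c = a cosθ` (`c² = a²(1 − sin²θ)`), `P = r² + c²` is `ϱ²` of `KerrDualMetricForm`.
[cite: Hintz2026, TeX l.3589 (ϱ_a² = r² + a²cos²θ)] -/
theorem P_eq_rhoSq (a r s2 c : ℝ) (hc : c ^ 2 = a ^ 2 * (1 - s2)) : r ^ 2 + c ^ 2 = rhoSq a r s2 := by
  rw [rhoSq, hc]

/-! ## 4. The closing step of Lemma 6.4 (H l.6021–6023) and the audit datum SRC-A40 -/

/-- The nilpotent matrix of (6.16c): `N = [[0,1,0,0],[0,0,1,0],[0,0,0,0],[0,0,0,0]]` (acting on coefficient vectors in the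
splitting (6.16b)). [cite: Hintz2026, eq. (6.16c) `EqWGTrMarckNabla` TeX l.6015-6018 (transcription)] -/
def Nmat : Matrix (Fin 4) (Fin 4) ℝ := !![0, 1, 0, 0; 0, 0, 1, 0; 0, 0, 0, 0; 0, 0, 0, 0]

/-- `N(u₀,u₁,u₂,u₃) = (u₁,u₂,0,0)`. [cite: Hintz2026, eq. (6.16c) TeX l.6015-6018 (computed)] -/
theorem N_mulVec (u : Fin 4 → ℝ) : Nmat.mulVec u = ![u 1, u 2, 0, 0] := by
  ext i; fin_cases i <;> simp [Nmat, Matrix.mulVec, dotProduct, Fin.sum_univ_four]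

/-- The printed inner product "`diag(1, η⁻¹, η⁻², η⁻³)` in the splitting (6.16b)" through its positive multiple
`η³·diag(1,η⁻¹,η⁻²,η⁻³) = diag(η³, η², η, 1)`, written with `η = t²`: `⟨u,v⟩_t = t⁶u₀v₀ + t⁴u₁v₁ + t²u₂v₂ + u₃v₃`
(a positive constant multiple of an inner product has the same adjoints, operator norms and sign conditions).
[cite: Hintz2026, proof of Lemma 6.4 TeX l.6022 (transcription up to the factor η³)] -/
def ipP (t : ℝ) (u v : Fin 4 → ℝ) : ℝ := t ^ 6 * (u 0 * v 0) + t ^ 4 * (u 1 * v 1) + t ^ 2 * (u 2 * v 2) + u 3 * v 3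

/-- `ipP t = t⁶ ×` the printed `diag(1, η⁻¹, η⁻², η⁻³)`, `η = t²` (`t ≠ 0`). [cite: Hintz2026, proof of Lemma 6.4 TeX l.6022 (computed)] -/
theorem ipP_eq_scaled_printed (t : ℝ) (ht : t ≠ 0) (u v : Fin 4 → ℝ) :
    ipP t u v = t ^ 6 * (u 0 * v 0 + u 1 * v 1 / t ^ 2 + u 2 * v 2 / (t ^ 2) ^ 2 + u 3 * v 3 / (t ^ 2) ^ 3) := by
  simp only [ipP]
  field_simp

/-- `⟨u,u⟩_t ≥ 0`. [folklore] -/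
theorem ipP_self_nonneg (t : ℝ) (u : Fin 4 → ℝ) : 0 ≤ ipP t u u := by
  have h0 := mul_nonneg (by positivity : (0 : ℝ) ≤ t ^ 6) (mul_self_nonneg (u 0))
  have h1 := mul_nonneg (by positivity : (0 : ℝ) ≤ t ^ 4) (mul_self_nonneg (u 1))
  have h2 := mul_nonneg (by positivity : (0 : ℝ) ≤ t ^ 2) (mul_self_nonneg (u 2))
  have h3 := mul_self_nonneg (u 3)
  simp only [ipP]
  linarith

/-- **`‖Nu‖²_t = t⁶u₁² + t⁴u₂² ≤ t²·‖u‖²_t`**: for the printed weights the operator norm of `N` is AT MOST `η^{1/2} = t`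
(the same computation with `t = η`, i.e. the weights `diag(1,η⁻²,η⁻⁴,η⁻⁶)`, gives the printed `𝒪(η)`).
[cite: Hintz2026, proof of Lemma 6.4 TeX l.6022 ("has operator norm of size O(η)"; computed: η^{1/2}, audit datum SRC-A40)] -/
theorem normSq_N_le (t : ℝ) (u : Fin 4 → ℝ) :
    ipP t (Nmat.mulVec u) (Nmat.mulVec u) ≤ t ^ 2 * ipP t u u := by
  rw [N_mulVec]
  simp only [ipP, Matrix.cons_val_zero, Matrix.cons_val_one, Matrix.cons_val]
  nlinarith [sq_nonneg (t ^ 4 * u 0), sq_nonneg (t * u 3)]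

/-- … with EQUALITY at `u = 𝖾¹ = (0,1,0,0)` (`‖N𝖾¹‖²_t = t⁶ = t²·‖𝖾¹‖²_t`, `‖𝖾¹‖²_t = t⁴ ≠ 0`): the operator norm of `N` for
`diag(1,η⁻¹,η⁻²,η⁻³)` is EXACTLY `η^{1/2}`. [cite: Hintz2026, proof of Lemma 6.4 TeX l.6022 (audit datum SRC-A40, computed)] -/
theorem normSq_N_witness (t : ℝ) :
    ipP t (Nmat.mulVec ![0, 1, 0, 0]) (Nmat.mulVec ![0, 1, 0, 0]) = t ^ 2 * ipP t ![0, 1, 0, 0] ![0, 1, 0, 0] ∧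
      ipP t ![(0 : ℝ), 1, 0, 0] ![0, 1, 0, 0] = t ^ 4 := by
  rw [N_mulVec]
  simp only [ipP, Matrix.cons_val_zero, Matrix.cons_val_one, Matrix.cons_val]
  constructor <;> ring

/-- Auxiliary: if `Ct < 1` then `(Ct²)²t⁴ < t⁶` (`t > 0`, `C ≥ 0`). [folklore] -/
theorem norm_N_not_O_eta_aux (C t : ℝ) (hC : 0 ≤ C) (ht : 0 < t) (hCt : C * t < 1) :
    (C * t ^ 2) ^ 2 * t ^ 4 < t ^ 6 := by
  have h0 : 0 ≤ C * t := mul_nonneg hC ht.le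
  have h1 : (C * t) ^ 2 < 1 := by nlinarith
  have h6 : 0 < t ^ 6 := by positivity
  nlinarith [mul_lt_mul_of_pos_right h1 h6]

/-- **SRC-A40 as a statement**: no constant `C` gives `‖N‖ ≤ Cη` for all small `η` — for every `C > 0` there is
`t ∈ (0,1)` (`η = t²`) with `(Cη)²·‖𝖾¹‖²_t < ‖N𝖾¹‖²_t`.  ("of size `𝒪(η)`" is true of the SQUARED norm.)
[cite: Hintz2026, proof of Lemma 6.4 TeX l.6022 (audit datum SRC-A40, computed)] -/
theorem norm_N_not_O_eta (C : ℝ) (hC : 0 < C) :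
    ∃ t : ℝ, 0 < t ∧ t < 1 ∧
      (C * t ^ 2) ^ 2 * ipP t ![0, 1, 0, 0] ![0, 1, 0, 0] < ipP t (Nmat.mulVec ![0, 1, 0, 0]) (Nmat.mulVec ![0, 1, 0, 0]) := by
  obtain ⟨h1, h2⟩ := normSq_N_witness (1 / (2 * (C + 1)))
  have ht : (0 : ℝ) < 1 / (2 * (C + 1)) := by positivity
  have hCt : C * (1 / (2 * (C + 1))) < 1 := by
    rw [mul_one_div, div_lt_one (by positivity)]; linarith
  refine ⟨1 / (2 * (C + 1)), ht, ?_, ?_⟩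
  · rw [div_lt_one (by positivity)]; linarith
  · rw [h1, h2]
    calc (C * (1 / (2 * (C + 1))) ^ 2) ^ 2 * (1 / (2 * (C + 1))) ^ 4
        < (1 / (2 * (C + 1))) ^ 6 := norm_N_not_O_eta_aux C _ hC.le ht hCt
      _ = (1 / (2 * (C + 1))) ^ 2 * (1 / (2 * (C + 1))) ^ 4 := by ring

/-- `⟨Nu,u⟩_t = t⁶u₁u₀ + t⁴u₂u₁` (the "real part" pairing). [cite: Hintz2026, proof of Lemma 6.4 TeX l.6022 (computed)] -/
theorem ipP_N (t : ℝ) (u : Fin 4 → ℝ) : ipP t (Nmat.mulVec u) u = t ^ 6 * (u 1 * u 0) + t ^ 4 * (u 2 * u 1) := by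
  rw [N_mulVec]
  simp only [ipP, Matrix.cons_val_zero, Matrix.cons_val_one, Matrix.cons_val]
  ring

/-- **Real part at most `η^{1/2}`**: `⟨Nu,u⟩_t ≤ t‖u‖²_t` (`t ≥ 0`), by the sum of squares
`t‖u‖² − ⟨Nu,u⟩ = (t/4)(2t³u₀ − t²u₁)² + (t/12)(3t²u₁ − 2tu₂)² + (2t/3)(tu₂)² + tu₃²`.
[cite: Hintz2026, proof of Lemma 6.4 TeX l.6022 ("and thus also real part of size O(η)"; computed: η^{1/2})] -/
theorem realPart_N_le (t : ℝ) (ht : 0 ≤ t) (u : Fin 4 → ℝ) : ipP t (Nmat.mulVec u) u ≤ t * ipP t u u := by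
  rw [ipP_N]
  simp only [ipP]
  nlinarith [mul_nonneg ht (sq_nonneg (2 * t ^ 3 * u 0 - t ^ 2 * u 1)),
    mul_nonneg ht (sq_nonneg (3 * t ^ 2 * u 1 - 2 * t * u 2)), mul_nonneg ht (sq_nonneg (t * u 2)),
    mul_nonneg ht (sq_nonneg (u 3))]

/-- … and at least `−η^{1/2}`: `−t‖u‖²_t ≤ ⟨Nu,u⟩_t`. [cite: Hintz2026, proof of Lemma 6.4 TeX l.6022 (computed)] -/
theorem realPart_N_ge (t : ℝ) (ht : 0 ≤ t) (u : Fin 4 → ℝ) : -(t * ipP t u u) ≤ ipP t (Nmat.mulVec u) u := by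
  rw [ipP_N]
  simp only [ipP]
  nlinarith [mul_nonneg ht (sq_nonneg (2 * t ^ 3 * u 0 + t ^ 2 * u 1)),
    mul_nonneg ht (sq_nonneg (3 * t ^ 2 * u 1 + 2 * t * u 2)), mul_nonneg ht (sq_nonneg (t * u 2)),
    mul_nonneg ht (sq_nonneg (u 3))]

/-- Witness for the real part: `u = (1, t, 0, 0)` gives `⟨Nu,u⟩_t = t⁷` and `‖u‖²_t = 2t⁶`, ratio `η^{1/2}/2`.
[cite: Hintz2026, proof of Lemma 6.4 TeX l.6022 (audit datum SRC-A40, computed)] -/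
theorem realPart_N_witness (t : ℝ) :
    ipP t (Nmat.mulVec ![1, t, 0, 0]) ![1, t, 0, 0] = t ^ 7 ∧ ipP t ![(1 : ℝ), t, 0, 0] ![1, t, 0, 0] = 2 * t ^ 6 := by
  rw [ipP_N]
  simp only [ipP, Matrix.cons_val_zero, Matrix.cons_val_one, Matrix.cons_val]
  constructor <;> ring

/-- **Lemma 6.4's closing step, in either reading (NIL)**: for every `ε > 0` the printed weights with `η = t²`,
`t = ε/4` (so `η = ε²/16` rather than "a small multiple of ε") give `−⟨(N + N*)u, u⟩_t = −2⟨Nu,u⟩_t ≤ (ε/2)‖u‖²_t`;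
granted (6.16c) `∇_{H_G} = H_G + 2σN` and `H_G* = −H_G` for the constant componentwise inner product (H l.7530), this is
`σ⁻¹(2i)⁻¹(S_sub − S_sub*) = −(N + N*) < ε` at `Γ₀`, i.e. (6.14). [cite: Hintz2026, Lemma 6.4 `LemmaWGTr` eq. (6.14) TeX l.5977-5980 and proof l.6021-6023 (the finite-dimensional step reproduced; the Lemma itself is a claim under review)] -/
theorem lemma64_closing (ε : ℝ) (hε : 0 < ε) (u : Fin 4 → ℝ) :
    -(2 * ipP (ε / 4) (Nmat.mulVec u) u) ≤ ε / 2 * ipP (ε / 4) u u := by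
  have h := realPart_N_ge (ε / 4) (by positivity) u
  linarith

end Literature.Geometry.Lorentzian.Hintz2026.CarterTetradFrame

end
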